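import Mathlib

/-!
# `SignCone.SignConeFarField`, line `Sketch` — stub `stub_intThree`
(item stmt-RiemannHypothesis-16305, route route-RiemannHypothesis-SignCone)

The closed-form integral over the third piece `[t₂, log 2]`, `t₂ = 2 log(7/6)`, of the rational-in-`u`
minorant `φ₃(x) = u/(u−1) − (36/85)u(u−1) − 2u − 2/u`, `u = e^{x/2}`:

`4/25 ≤ ∫_{2 log(7/6)}^{log 2} φ₃(x) dx` (true value `0.16953…`).

Proof: `G(x) = 2 log(e^{x/2} − 1) − (36/85)(e^{x/2} − 1)² − 4e^{x/2} + 4e^{−x/2}` is a primitive of `φ₃`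
on `(0, ∞)` (FTC, `intervalIntegral.integral_eq_sub_of_hasDerivAt`); at the endpoints
`e^{t₂/2} = 7/6` and `E = e^{(log 2)/2}` with `E² = 2`, so `G(log 2) − G(t₂)` is linear in `E`, `log 2`,
`log 3` and `log(E − 1) = −log(E + 1)`; the latter is bounded by `log y ≤ y − 1` anchored at `12/5`,
and Mathlib's nine-digit bounds on `log 2`, `log 3`, `log 5` finish.
-/

noncomputable section

-- `Summit.RiemannHypothesis.RiemannHypothesis.…` repeats a namespace component by design (D-0017 layout).
set_option linter.dupNamespace false

namespace Summit.RiemannHypothesis.RiemannHypothesis.Theorems.SignConeFarField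

/-- For `0 < x` the denominator `e^{x/2} − 1` of `φ₃` does not vanish. -/
private theorem exp_half_sub_one_ne_zero {x : ℝ} (hx : 0 < x) : Real.exp (x / 2) - 1 ≠ 0 := by
  have := Real.add_one_le_exp (x / 2)
  intro h
  linarith

/-- The explicit primitive `G(x) = 2 log(e^{x/2} − 1) − (36/85)(e^{x/2} − 1)² − 4e^{x/2} + 4e^{−x/2}`
has derivative `φ₃(x)` at every `x > 0`. -/
private theorem hasDerivAt_prim3 {x : ℝ} (hx : 0 < x) :
    HasDerivAt (fun x : ℝ => 2 * Real.log (Real.exp (x / 2) - 1)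
        - 36 / 85 * ((Real.exp (x / 2) - 1) * (Real.exp (x / 2) - 1))
        - 4 * Real.exp (x / 2) + 4 * Real.exp (-(x / 2)))
      (Real.exp (x / 2) / (Real.exp (x / 2) - 1) - 36 / 85 * (Real.exp (x / 2) * (Real.exp (x / 2) - 1)) -
        2 * Real.exp (x / 2) - 2 * Real.exp (-(x / 2))) x := by
  have hne : Real.exp (x / 2) - 1 ≠ 0 := exp_half_sub_one_ne_zero hx
  have h1 : HasDerivAt (fun x : ℝ => x / 2) (1 / 2) x := (hasDerivAt_id x).div_const 2
  have h2 : HasDerivAt (fun x : ℝ => Real.exp (x / 2)) (Real.exp (x / 2) * (1 / 2)) x := h1.exp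
  have h3 : HasDerivAt (fun x : ℝ => Real.exp (x / 2) - 1) (Real.exp (x / 2) * (1 / 2)) x :=
    h2.sub_const 1
  have h4 : HasDerivAt (fun x : ℝ => Real.log (Real.exp (x / 2) - 1))
      (Real.exp (x / 2) * (1 / 2) / (Real.exp (x / 2) - 1)) x := h3.log hne
  have h5 : HasDerivAt (fun x : ℝ => (Real.exp (x / 2) - 1) * (Real.exp (x / 2) - 1))
      (Real.exp (x / 2) * (1 / 2) * (Real.exp (x / 2) - 1)
        + (Real.exp (x / 2) - 1) * (Real.exp (x / 2) * (1 / 2))) x := h3.fun_mul h3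
  have h6 : HasDerivAt (fun x : ℝ => -(x / 2)) (-(1 / 2)) x := h1.fun_neg
  have h7 : HasDerivAt (fun x : ℝ => Real.exp (-(x / 2))) (Real.exp (-(x / 2)) * -(1 / 2)) x := h6.exp
  have h8 := (((h4.const_mul 2).fun_sub (h5.const_mul (36 / 85))).fun_sub (h2.const_mul 4)).fun_add
    (h7.const_mul 4)
  refine h8.congr_deriv ?_
  field_simp
  ring

/-- `φ₃` is continuous at every `x > 0`. -/
private theorem continuousAt_phi3 {x : ℝ} (hx : 0 < x) :
    ContinuousAt (fun x : ℝ => Real.exp (x / 2) / (Real.exp (x / 2) - 1)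
        - 36 / 85 * (Real.exp (x / 2) * (Real.exp (x / 2) - 1))
        - 2 * Real.exp (x / 2) - 2 * Real.exp (-(x / 2))) x := by
  have hne : Real.exp (x / 2) - 1 ≠ 0 := exp_half_sub_one_ne_zero hx
  fun_prop (disch := exact hne)

/-- **Stub (the integral over `[t₂, log 2]`).** With `u = e^{x/2}`, the integral of
`φ₃ = u/(u−1) − (36/85)u(u−1) − 2u − 2/u` from `t₂ = 2 log(7/6)` to `log 2` is at least `4/25`
(its value is `0.16953…`). -/
theorem stub_intThree :
    (4 : ℝ) / 25 ≤ ∫ x in (2 * Real.log (7 / 6))..Real.log 2,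
      (Real.exp (x / 2) / (Real.exp (x / 2) - 1) - 36 / 85 * (Real.exp (x / 2) * (Real.exp (x / 2) - 1)) -
        2 * Real.exp (x / 2) - 2 * Real.exp (-(x / 2))) := by
  -- both endpoints are positive, hence so is every point of the interval
  have ha : 0 < 2 * Real.log (7 / 6) := by
    have := Real.log_pos (by norm_num : (1 : ℝ) < 7 / 6)
    linarith
  have hb : 0 < Real.log 2 := Real.log_pos (by norm_num)
  have hpos : ∀ x ∈ Set.uIcc (2 * Real.log (7 / 6)) (Real.log 2), 0 < x := by
    intro x hx
    rcases Set.mem_uIcc.mp hx with h | h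
    · linarith [h.1]
    · linarith [h.1]
  -- FTC with the explicit primitive
  have hderiv : ∀ x ∈ Set.uIcc (2 * Real.log (7 / 6)) (Real.log 2),
      HasDerivAt (fun x : ℝ => 2 * Real.log (Real.exp (x / 2) - 1)
        - 36 / 85 * ((Real.exp (x / 2) - 1) * (Real.exp (x / 2) - 1))
        - 4 * Real.exp (x / 2) + 4 * Real.exp (-(x / 2)))
      (Real.exp (x / 2) / (Real.exp (x / 2) - 1) - 36 / 85 * (Real.exp (x / 2) * (Real.exp (x / 2) - 1)) -
        2 * Real.exp (x / 2) - 2 * Real.exp (-(x / 2))) x :=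
    fun x hx => hasDerivAt_prim3 (hpos x hx)
  have hint : IntervalIntegrable (fun x : ℝ => Real.exp (x / 2) / (Real.exp (x / 2) - 1)
      - 36 / 85 * (Real.exp (x / 2) * (Real.exp (x / 2) - 1))
      - 2 * Real.exp (x / 2) - 2 * Real.exp (-(x / 2))) MeasureTheory.volume
      (2 * Real.log (7 / 6)) (Real.log 2) :=
    (continuousOn_of_forall_continuousAt fun x hx => continuousAt_phi3 (hpos x hx)).intervalIntegrable
  rw [intervalIntegral.integral_eq_sub_of_hasDerivAt hderiv hint]
  -- values at the lower endpoint: `e^{t₂/2} = 7/6`, `e^{-t₂/2} = 6/7`, `log(7/6 − 1) = −log 6`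
  have h76 : Real.exp (2 * Real.log (7 / 6) / 2) = 7 / 6 := by
    have : 2 * Real.log (7 / 6) / 2 = Real.log (7 / 6) := by ring
    rw [this, Real.exp_log (by norm_num)]
  have h67 : Real.exp (-(2 * Real.log (7 / 6) / 2)) = 6 / 7 := by
    rw [Real.exp_neg, h76]
    norm_num
  have hlog16 : Real.log (7 / 6 - 1) = -(Real.log 2 + Real.log 3) := by
    have : (7 : ℝ) / 6 - 1 = (2 * 3)⁻¹ := by norm_num
    rw [this, Real.log_inv, Real.log_mul (by norm_num) (by norm_num)]
  -- values at the upper endpoint: `E = e^{(log 2)/2}`, `E² = 2`, `e^{-(log 2)/2} = E/2`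
  have hE2 : Real.exp (Real.log 2 / 2) * Real.exp (Real.log 2 / 2) = 2 := by
    rw [← Real.exp_add, add_halves, Real.exp_log two_pos]
  have hEinv : Real.exp (-(Real.log 2 / 2)) = Real.exp (Real.log 2 / 2) / 2 := by
    rw [Real.exp_neg]
    exact inv_eq_of_mul_eq_one_left (by linear_combination hE2 / 2)
  rw [h76, h67, hlog16, hEinv]
  set E := Real.exp (Real.log 2 / 2) with hE
  have hEpos : 0 < E := Real.exp_pos _
  have hElo : (1.4142135 : ℝ) < E := by nlinarith [hE2, hEpos]
  have hEhi : E < (1.4142136 : ℝ) := by nlinarith [hE2, hEpos]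
  -- `log(E − 1) = −log(E + 1)` since `(E − 1)(E + 1) = 1`
  have hlogE : Real.log (E - 1) = -Real.log (E + 1) := by
    rw [← Real.log_inv]
    congr 1
    exact eq_inv_of_mul_eq_one_left (by linear_combination hE2)
  -- `log(E + 1) ≤ log(12/5) + (5(E+1)/12 − 1)` and `log(12/5) = 2 log 2 + log 3 − log 5`
  have hlogE1 : Real.log (E + 1) ≤ 2 * Real.log 2 + Real.log 3 - Real.log 5 + (5 * (E + 1) / 12 - 1) := by
    have hy : 0 < 5 * (E + 1) / 12 := by linarith
    have h12 : Real.log (12 / 5) = 2 * Real.log 2 + Real.log 3 - Real.log 5 := by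
      have : (12 : ℝ) / 5 = 2 * 2 * 3 / 5 := by norm_num
      rw [this, Real.log_div (by norm_num) (by norm_num), Real.log_mul (by norm_num) (by norm_num),
        Real.log_mul (by norm_num) (by norm_num)]
      ring
    have hsplit : Real.log (E + 1) = Real.log (12 / 5) + Real.log (5 * (E + 1) / 12) := by
      rw [← Real.log_mul (by norm_num) hy.ne']
      congr 1
      ring
    have h3 := Real.log_le_sub_one_of_pos hy
    linarith
  have hsq : (E - 1) * (E - 1) = 3 - 2 * E := by linear_combination hE2
  rw [hlogE, hsq]
  have l2l := Real.log_two_gt_d9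
  have l2u := Real.log_two_lt_d9
  have l3l := Real.log_three_gt_d9
  have l3u := Real.log_three_lt_d9
  have l5l := Real.log_five_gt_d9
  linarith

end Summit.RiemannHypothesis.RiemannHypothesis.Theorems.SignConeFarField

end
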